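/-
Copyright (c) 2026. All rights reserved.
Released under Apache 2.0 license as described in the file LICENSE.
Authors: abc-iut cell, prover seat abc-iut-L4-t8 (gen 12; cell row «LTIMES-SUM-CARRIER», L4-lead m184), over abc-iut-w6-d025's sum
construction (twinned over `⋉`: `Ltimes/LogFrobeniusSettingSum.lean`, `Ltimes/LogFrobeniusSettingSumCoherence.lean`), abc-iut-f-101's
genuine open carrier restricted along `toLtimes` (`Ltimes/LogFrobeniusRestrictCoherence.lean`) and abc-iut-L4-t6's `⋉`-carrier with
genuine archimedean `⊞`-side (`Ltimes/LogFrobeniusArchGenuinePlus*.lean`); everything consumed BY NAME.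
-/
import Literature.AnabelianGeometry.AbsoluteAnabelian.Ltimes.LogFrobeniusSettingSumCoherence
import Literature.AnabelianGeometry.AbsoluteAnabelian.Ltimes.LogFrobeniusRestrictCoherence
import Literature.AnabelianGeometry.AbsoluteAnabelian.Ltimes.LogFrobeniusArchGenuinePlusEtaNatural
import Literature.AnabelianGeometry.AbsoluteAnabelian.Ltimes.LogFrobeniusMonoTelecoreIotaContact
import Literature.AnabelianGeometry.AbsoluteAnabelian.LogFrobeniusIotaEtaSquareGenuineOpen
import Literature.AnabelianGeometry.AbsoluteAnabelian.LogFrobeniusIotaAnMonoChains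
import HarnessLib

/-!
# [AbsTopIII] Cor 5.10 (iv) at ONE `⋉`-setting carrying BOTH kinds of place: the two-sided `⋉`-carrier (cell row «LTIMES-SUM-CARRIER»)

S. Mochizuki, *Topics in absolute anabelian geometry III*, J. Math. Sci. Univ. Tokyo 22 (2015) [MochizukiAbsTopIII2015]; manuscript
`paper:url-5493eb38cbb7`, read on the page: Cor 5.10 (iv)(a)–(c) pp. 147–148 ("for `v ∈ 𝕍^non` (respectively, `v ∈ 𝕍^arc`) …",
i.e. ONE global log-Frobenius picture over ALL of `𝕍(F_mod)`), Def 5.4 (vii) p. 128 / Cor 5.5 (iii) p. 131 (`ι⊞` on `Γ⃗^⋉_v`),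
Prop 5.8 (vii) p. 141, Rmk 5.8.1 (i) p. 142 (orientation signs at archimedean places).

L4-lead m184: the DELTA #4 reading of Cor 5.10 (iv) must be taken at ONE setting carrying both place types, not at an arc-only and a
nonarch-only carrier separately.  THIS FILE builds it over the `⋉`-successor interface:
* ★ `genuineTwoSidedSumLtimes p 𝔄 V₁ V₂ := (genuineOpen p V₁).toLtimes.sum (archGenuinePlus 𝔄 V₂ (fun _ => true))` — index set `V₁ ⊕ V₂`,
  `isArc := Sum.elim (fun _ => false) (fun _ => true)` (= `Sum.isRight` pointwise): abc-iut-f-101's genuine open-augmentation rows at the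
  places of `V₁` (restricted along `toLtimes`, abc-iut-L4-t3's S1b — nothing rebuilt) glued with abc-iut-L4-t6's `⋉`-carrier with GENUINE
  archimedean `TH⊞`/`TB⊞` rows at the places of `V₂`, by abc-iut-w6-d025's generic sum (twinned over `⋉`);
* its mono-analyticization homotopies, Cor 5.10 (iv)(a) (`V₁ ⊕ V₂ ≠ ∅`), its `hψ`;
* ★★ `genuineTwoSidedSumLtimes_monoTelecoreCoherence` — abc-iut-L4-t3's add-on `MonoTelecoreCoherence` at the two-sided carrier, SUMMAND-WISE:
  abc-iut-f-101's `monoTelecoreCoherence_open` (restricted) ⊕ abc-iut-L4-t6's `archGenuinePlus_monoTelecoreCoherence` (under the orientation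
  cochain `(c, hc, hcob)` — NECESSARY, abc-iut-w5-d038's `ArchimedeanHolGroupPairsEtaNoGo`); ★★ the PINNED Cor 5.10 (iv)(b)(c) there
  (`…_cor510MonoTelecorePinned`, abc-iut-f-101's sufficiency theorem over `⋉`, my relay slice T7b);
* ★★★ the `ι^{An⊢⊞}`/`η⊢`-LEGS AND THE PINNED-WITH-`ι` ROW (`F-0139″`) at the two-sided carrier, summand-wise: `…_iotaAnMono`
  (`sumIotaAnMono` of the restricted genuine `ι^{An⊢⊞}` at `p` and abc-iut-L4-t3's `archGenuinePlus_iotaAnMono`), `…_squaresCommute`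
  (`squaresCommute_sum`, proved here), `…_etaNatural` (abc-iut-w6-d025's `etaNatural_sum` of `etaNatural_genuineOpen` restricted
  and `archGenuinePlus_etaNatural`), hence ★★★ `…_cor510MonoTelecorePinnedIota` by abc-iut-L4-t3's sufficiency theorem over `⋉`
  (`MonoTelecoreCoherence.cor510MonoTelecorePinnedIota_of`, T8-6) — under the cochain; and
* ★★★ `HolRS.cor510MonoTelecorePinnedIota_genuineTwoSidedSumLtimes_geometric` /
  `HolRS.cor510MonoTelecorePinned_genuineTwoSidedSumLtimes_geometric` — at the geometric Aut-holomorphic field functor of any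
  class `Q` of hyperbolic Riemann surfaces the cochain exists (`HolRS.exists_orientationCochain_geometric`): BOTH pinned rows and
  the coherence add-on hold at the two-sided `⋉`-carrier with ZERO hypotheses beyond `V₁ ⊕ V₂ ≠ ∅`;
* `twoPrimeOpenLtimes p ℓ V₁ V₂` — two residue characteristics in one `⋉`-setting, everything hypothesis-free; and the
  nonarchimedean transfers `iotaData_openLtimes` / `squaresCommute_openLtimes` / `etaNatural_openLtimes` /
  `cor510MonoTelecorePinnedIota_openLtimes` (the frozen genuine facts read over `⋉` along `toLtimes`, definitionally).
HONEST LABEL: MODEL-LEVEL two-factor proxy of `Th•_T[Z]` (`𝒳 = 𝒳^{open}_p × 𝒞^hol_{TH⊞}`-side), abc-iut-L4-t6's honest limits (L2/L-N⊢/L4) on the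
arc factor inherited; a carrier of OUR successor typing, print unchanged; refereed pre-IUT material; nothing here bears on
[IUTchIII] Cor. 3.12; no side taken; instantiated ≠ endorsed; typed ≠ proved.
-/

set_option autoImplicit false

noncomputable section

universe v₁ v₂ u₁ u₂ u

open CategoryTheory

namespace Literature.AnabelianGeometry.AbsoluteAnabelian

/-! ## §0. Generic complements: the `ι^{An⊢⊞}`-square is inherited by sums -/

/-- Transport of the `ι`-square of Def 5.4 (iii) along any composition-preserving operation on arrows (used with `– × 𝟙` and
`𝟙 × –`). [cite: MochizukiAbsTopIII2015, Def 5.4 (iii) p. 126] -/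
theorem LogVertex.SquaresCommuteF.map {C : Type u₁} [Category.{v₁} C] {D : Type u₂} [Category.{v₂} D] :
    ∀ (b : Bool) (F : {ν : LogVertex b // ν.IsCross} → C)
      (ιF : ∀ {μ₁ μ₂ : LogVertex b} (ε : LogEdgeTS b μ₁ μ₂) (hε : ε.InCore), F ⟨μ₁, hε.isCross_src⟩ ⟶ F ⟨μ₂, hε.isCross_tgt⟩)
      (G : C → D) (Gm : ∀ {X Y : C}, (X ⟶ Y) → (G X ⟶ G Y))
      (_ : ∀ {X Y Z : C} (f : X ⟶ Y) (g : Y ⟶ Z), Gm (f ≫ g) = Gm f ≫ Gm g),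
      LogVertex.SquaresCommuteF b F ιF → LogVertex.SquaresCommuteF b (fun j => G (F j)) (fun ε hε => Gm (ιF ε hε))
  | false, _, _, _, Gm, hG, h => by
    dsimp only [LogVertex.SquaresCommuteF] at h ⊢
    rw [← hG, ← hG, h]
  | true, _, _, _, _, _, _ => trivial

namespace LogFrobeniusSettingLtimes

section SumSquares

variable {V₁ V₂ : Type u} {isArc₁ : V₁ → Bool} {isArc₂ : V₂ → Bool}
  {Lt₁ : LogFrobeniusSettingLtimes V₁ isArc₁} {Lt₂ : LogFrobeniusSettingLtimes V₂ isArc₂}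
  {hψ₁ : ∀ (w : V₁) (j : {ν : LogVertex (isArc₁ w) // ν.IsCross}),
    Lt₁.ψAnMono w j ⋙ Lt₁.forgetMono w ⋙ Lt₁.toEmono w ≅ Lt₁.κAnMono.inverse}
  {hψ₂ : ∀ (w : V₂) (j : {ν : LogVertex (isArc₂ w) // ν.IsCross}),
    Lt₂.ψAnMono w j ⋙ Lt₂.forgetMono w ⋙ Lt₂.toEmono w ≅ Lt₂.κAnMono.inverse}
  {I₁ : Lt₁.IotaAnMono hψ₁} {I₂ : Lt₂.IotaAnMono hψ₂}

/-- ★ **the `ι^{An⊢⊞}`-square of Def 5.4 (iii) is inherited by the sum** (`ι₁ × 𝟙` at `inl w`, `𝟙 × ι₂` at `inr w`): complement to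
abc-iut-w6-d025's `sumIotaAnMono`. [cite: MochizukiAbsTopIII2015, Def 5.4 (iii) p. 126] -/
theorem squaresCommute_sum (h₁ : I₁.SquaresCommute) (h₂ : I₂.SquaresCommute) : (sumIotaAnMono I₁ I₂).SquaresCommute := by
  rintro (w | w)
  · exact LogVertex.SquaresCommuteF.map (isArc₁ w) (fun j => Lt₁.ψAnMono w j) (fun ε hε => I₁.ι w ε hε)
      (fun P => P.prod Lt₂.κAnMono.inverse) (fun α => NatTrans.prod α (𝟙 Lt₂.κAnMono.inverse))
      (fun f g => by ext X; exacts [rfl, (Category.comp_id _).symm]) (h₁ w)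
  · exact LogVertex.SquaresCommuteF.map (isArc₂ w) (fun j => Lt₂.ψAnMono w j) (fun ε hε => I₂.ι w ε hε)
      (fun P => Lt₁.κAnMono.inverse.prod P) (fun α => NatTrans.prod (𝟙 Lt₁.κAnMono.inverse) α)
      (fun f g => by ext X; exacts [(Category.comp_id _).symm, rfl]) (h₂ w)

end SumSquares

end LogFrobeniusSettingLtimes

/-! ## §0b. The frozen genuine nonarchimedean `ι^{An⊢⊞}`/`η⊢`-facts, read over `⋉` along `toLtimes` -/

namespace LogFrobeniusSetting

open AbsTopIII

variable (p : ℕ) [Fact p.Prime] (Vmod : Type 1)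

/-- abc-iut-w5-d053 / abc-iut-w4-d095's GENUINE `ι^{An⊢⊞}`-data at `genuineOpen p V`, restricted along `toLtimes` (S1b), as the
`ι`-datum of abc-iut-f-101's restricted coherence datum `monoTelecoreCoherence_openLtimes`. [cite: MochizukiAbsTopIII2015, Prop 5.8 (vii) p. 142] -/
def iotaData_openLtimes : (monoTelecoreCoherence_openLtimes p Vmod).IotaData :=
  IotaAnMono.toLtimes (genuineOpen p Vmod) (nonarchGenuineMonoAnPfOpen_iotaAnMono p Vmod (fun _ => false))

/-- `squaresCommute_genuineOpen`, read over `⋉` (same `ι`, same `ψ^{An⊢⊞}`: definitionally the frozen statement).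
[cite: MochizukiAbsTopIII2015, Def 5.4 (iii) p. 126] -/
theorem squaresCommute_openLtimes : (iotaData_openLtimes p Vmod).SquaresCommute :=
  squaresCommute_genuineOpen p Vmod

/-- ★ `etaNatural_genuineOpen` (abc-iut-L4-t3), read over `⋉`: the `η⊢`-naturality square of Cor 5.10 (iv)(c) HOLDS for the
restricted genuine data (`toLtimes` keeps `η⊢`, `ι^{An⊢⊞}` and — along the edges of `Γ⃗×_v`, all nonarchimedean here — `ι⊞` on the nose).
[cite: MochizukiAbsTopIII2015, Cor 5.10 (iv)(c) p. 148] -/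
theorem etaNatural_openLtimes : (monoTelecoreCoherence_openLtimes p Vmod).EtaNatural (iotaData_openLtimes p Vmod) :=
  etaNatural_genuineOpen p Vmod

/-- hence `F-0139″` (the pinned-with-`ι` row) at `(genuineOpen p V).toLtimes`, `V ≠ ∅`, by abc-iut-L4-t3's sufficiency theorem
over `⋉`. [cite: MochizukiAbsTopIII2015, Cor 5.10 (iv)(c) p. 148] -/
theorem cor510MonoTelecorePinnedIota_openLtimes [Nonempty Vmod] : (genuineOpen p Vmod).toLtimes.Cor510MonoTelecorePinnedIota :=
  (monoTelecoreCoherence_openLtimes p Vmod).cor510MonoTelecorePinnedIota_of (iotaData_openLtimes p Vmod)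
    (squaresCommute_openLtimes p Vmod) (etaNatural_openLtimes p Vmod)

end LogFrobeniusSetting

namespace LogFrobeniusSettingLtimes

open LogFrobeniusSetting AbsTopIII

/-! ## §1. Two residue characteristics in one `⋉`-setting -/

section TwoPrime

variable (p ℓ : ℕ) [Fact p.Prime] [Fact ℓ.Prime] (V₁ V₂ : Type 1)

/-- Genuine open-augmentation rows at `p` (places of `V₁`) and at `ℓ` (places of `V₂`) in ONE `⋉`-setting — both summands are
abc-iut-f-101's carrier restricted along `toLtimes`. [cite: MochizukiAbsTopIII2015, Prop 5.8 (vii) p. 141] -/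
abbrev twoPrimeOpenLtimes : LogFrobeniusSettingLtimes (V₁ ⊕ V₂) (Sum.elim (fun _ => false) (fun _ => false)) :=
  (genuineOpen p V₁).toLtimes.sum (genuineOpen ℓ V₂).toLtimes

/-- its mono-analyticization homotopies. [cite: MochizukiAbsTopIII2015, Cor 5.10 p. 146] -/
def twoPrimeOpenLtimes_monoAnalyticizationHomotopies : (twoPrimeOpenLtimes p ℓ V₁ V₂).MonoAnalyticizationHomotopies :=
  sumMonoAnalyticizationHomotopies (monoAnalyticizationHomotopies_openLtimes p V₁) (monoAnalyticizationHomotopies_openLtimes ℓ V₂)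

/-- abc-iut-L4-t3's add-on `MonoTelecoreCoherence` at `twoPrimeOpenLtimes`, summand-wise (abc-iut-f-101's, restricted; hypothesis-free).
[cite: MochizukiAbsTopIII2015, Cor 5.10 (iv)(c) p. 148] -/
def twoPrimeOpenLtimes_monoTelecoreCoherence :
    (twoPrimeOpenLtimes p ℓ V₁ V₂).MonoTelecoreCoherence (twoPrimeOpenLtimes_monoAnalyticizationHomotopies p ℓ V₁ V₂) :=
  sumMonoTelecoreCoherence (monoTelecoreCoherence_openLtimes p V₁) (monoTelecoreCoherence_openLtimes ℓ V₂)

/-- **Cor 5.10 (iv)(a) at `twoPrimeOpenLtimes`** (`V₁ ⊕ V₂ ≠ ∅`). [cite: MochizukiAbsTopIII2015, Cor 5.10 (iv)(a) p. 147] -/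
theorem twoPrimeOpenLtimes_cor510MonoCores [Nonempty (V₁ ⊕ V₂)] : (twoPrimeOpenLtimes p ℓ V₁ V₂).Cor510MonoCores :=
  cor510MonoCores_holds (twoPrimeOpenLtimes_monoAnalyticizationHomotopies p ℓ V₁ V₂)

/-- ★ **PINNED Cor 5.10 (iv)(b)(c) over `⋉` at two residue characteristics, zero hypotheses** beyond `V₁ ⊕ V₂ ≠ ∅`.
[cite: MochizukiAbsTopIII2015, Cor 5.10 (iv)(b)(c) pp. 147–148] -/
theorem twoPrimeOpenLtimes_cor510MonoTelecorePinned [Nonempty (V₁ ⊕ V₂)] : (twoPrimeOpenLtimes p ℓ V₁ V₂).Cor510MonoTelecorePinned :=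
  (twoPrimeOpenLtimes_monoTelecoreCoherence p ℓ V₁ V₂).cor510MonoTelecorePinned

/-- the `ι^{An⊢⊞}`-data there (genuine perfection arrows at both primes, restricted). [cite: MochizukiAbsTopIII2015, Prop 5.8 (vii) p. 142] -/
def twoPrimeOpenLtimes_iotaData : (twoPrimeOpenLtimes_monoTelecoreCoherence p ℓ V₁ V₂).IotaData :=
  sumIotaData (iotaData_openLtimes p V₁) (iotaData_openLtimes ℓ V₂)

/-- the `ι^{An⊢⊞}`-square there. [cite: MochizukiAbsTopIII2015, Def 5.4 (iii) p. 126] -/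
theorem twoPrimeOpenLtimes_squaresCommute : (twoPrimeOpenLtimes_iotaData p ℓ V₁ V₂).SquaresCommute :=
  squaresCommute_sum (squaresCommute_openLtimes p V₁) (squaresCommute_openLtimes ℓ V₂)

/-- the `η⊢`-square there, hypothesis-free. [cite: MochizukiAbsTopIII2015, Cor 5.10 (iv)(c) p. 148] -/
theorem twoPrimeOpenLtimes_etaNatural :
    (twoPrimeOpenLtimes_monoTelecoreCoherence p ℓ V₁ V₂).EtaNatural (twoPrimeOpenLtimes_iotaData p ℓ V₁ V₂) :=
  etaNatural_sum _ _ (etaNatural_openLtimes p V₁) (etaNatural_openLtimes ℓ V₂)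

/-- ★ **`F-0139″` (PINNED WITH `ι`) over `⋉` at two residue characteristics, zero hypotheses** beyond `V₁ ⊕ V₂ ≠ ∅`.
[cite: MochizukiAbsTopIII2015, Cor 5.10 (iv)(c) p. 148] -/
theorem twoPrimeOpenLtimes_cor510MonoTelecorePinnedIota [Nonempty (V₁ ⊕ V₂)] :
    (twoPrimeOpenLtimes p ℓ V₁ V₂).Cor510MonoTelecorePinnedIota :=
  (twoPrimeOpenLtimes_monoTelecoreCoherence p ℓ V₁ V₂).cor510MonoTelecorePinnedIota_of (twoPrimeOpenLtimes_iotaData p ℓ V₁ V₂)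
    (twoPrimeOpenLtimes_squaresCommute p ℓ V₁ V₂) (twoPrimeOpenLtimes_etaNatural p ℓ V₁ V₂)

end TwoPrime

/-! ## §2. The two-sided `⋉`-carrier: genuine nonarchimedean AND genuine archimedean rows in ONE setting -/

section TwoSided

variable (p : ℕ) [Fact p.Prime] (𝔄 : AutHolFieldFunctor.{0}) (V₁ V₂ : Type 1)

/-- ★ **THE TWO-SIDED `⋉`-CARRIER**: abc-iut-f-101's genuine open-augmentation rows at `p` (places of `V₁`, nonarchimedean; restricted
along `toLtimes`) and abc-iut-L4-t6's `⋉`-carrier with genuine archimedean `TH⊞`/`TB⊞` rows over the Aut-holomorphic field functor `𝔄`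
(places of `V₂`, archimedean) in ONE `LogFrobeniusSettingLtimes` over `V₁ ⊕ V₂`, `isArc := Sum.elim (fun _ => false) (fun _ => true)`.
[cite: MochizukiAbsTopIII2015, Prop 5.8 (vii) p. 141] -/
abbrev genuineTwoSidedSumLtimes : LogFrobeniusSettingLtimes (V₁ ⊕ V₂) (Sum.elim (fun _ => false) (fun _ => true)) :=
  (genuineOpen p V₁).toLtimes.sum (archGenuinePlus 𝔄 V₂ (fun _ => true))

/-- the kind-of-place map of the two-sided carrier is `Sum.isRight`. [cite: MochizukiAbsTopIII2015, Def 5.4 (i) p. 125] -/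
theorem isArc_genuineTwoSidedSumLtimes (v : V₁ ⊕ V₂) :
    Sum.elim (fun _ : V₁ => false) (fun _ : V₂ => true) v = v.isRight := by
  cases v <;> rfl

/-- `𝒳 = 𝒳^{open}_p × 𝒳^{arc⋉}_𝔄` (two-factor proxy of `Th•_T[Z]`). [cite: MochizukiAbsTopIII2015, Def 5.4 (i) p. 125] -/
theorem genuineTwoSidedSumLtimes_X :
    (genuineTwoSidedSumLtimes p 𝔄 V₁ V₂).X = ((genuineOpen p V₁).X × (archGenuinePlus 𝔄 V₂ (fun _ => true)).X) := rfl

/-- its mono-analyticization homotopies (abc-iut-f-101's at `p`, restricted; abc-iut-L4-t6's at the archimedean places).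
[cite: MochizukiAbsTopIII2015, Cor 5.10 p. 146] -/
def genuineTwoSidedSumLtimes_monoAnalyticizationHomotopies : (genuineTwoSidedSumLtimes p 𝔄 V₁ V₂).MonoAnalyticizationHomotopies :=
  sumMonoAnalyticizationHomotopies (monoAnalyticizationHomotopies_openLtimes p V₁)
    (archGenuinePlus_monoAnalyticizationHomotopies 𝔄 V₂ (fun _ => true))

/-- **Cor 5.10 (iv)(a) HOLDS at the two-sided `⋉`-carrier** (`V₁ ⊕ V₂ ≠ ∅`). [cite: MochizukiAbsTopIII2015, Cor 5.10 (iv)(a) p. 147] -/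
theorem genuineTwoSidedSumLtimes_cor510MonoCores [Nonempty (V₁ ⊕ V₂)] : (genuineTwoSidedSumLtimes p 𝔄 V₁ V₂).Cor510MonoCores :=
  cor510MonoCores_holds (genuineTwoSidedSumLtimes_monoAnalyticizationHomotopies p 𝔄 V₁ V₂)

/-- the `hψ` ("`ψ^{An⊢⊞}` over `ℰ⊢`") of the two-sided `⋉`-carrier, summand-wise. [cite: MochizukiAbsTopIII2015, Definition 5.6 (iv) p. 136] -/
def genuineTwoSidedSumLtimes_ψOverIso :
    ∀ (w : V₁ ⊕ V₂) (j : {ν : LogVertex (Sum.elim (fun _ => false) (fun _ => true) w) // ν.IsCross}),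
      (genuineTwoSidedSumLtimes p 𝔄 V₁ V₂).ψAnMono w j ⋙ (genuineTwoSidedSumLtimes p 𝔄 V₁ V₂).forgetMono w ⋙
          (genuineTwoSidedSumLtimes p 𝔄 V₁ V₂).toEmono w ≅
        (genuineTwoSidedSumLtimes p 𝔄 V₁ V₂).κAnMono.inverse :=
  sumψOverIso (nonarchGenuineMonoAnPfOpen_ψOverIso p V₁ (fun _ => false)) (archGenuinePlus_ψOverIso 𝔄 V₂ (fun _ => true))

/-- ★★ **abc-iut-L4-t3's add-on `MonoTelecoreCoherence` AT THE TWO-SIDED `⋉`-CARRIER**, summand-wise: abc-iut-f-101's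
`monoTelecoreCoherence_open` (restricted along `toLtimes`, hypothesis-free) at the places of `V₁`, abc-iut-L4-t6's
`archGenuinePlus_monoTelecoreCoherence` at the places of `V₂` — under the orientation cochain `(c, hc, hcob)` for the transition signs of `𝔄`
(NECESSARY: abc-iut-w5-d038's `ArchimedeanHolGroupPairsEtaNoGo`; Rmk 5.8.1 (i)). [cite: MochizukiAbsTopIII2015, Cor 5.10 (iv)(c) p. 148] -/
def genuineTwoSidedSumLtimes_monoTelecoreCoherence (c : 𝔄.EA → ℝ) (hc : ∀ X : 𝔄.EA, c X = 1 ∨ c X = -1)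
    (hcob : ∀ {X Y : 𝔄.EA} (f : X ⟶ Y), AutHolFieldFunctor.transitionSign f = c X * c Y) :
    (genuineTwoSidedSumLtimes p 𝔄 V₁ V₂).MonoTelecoreCoherence (genuineTwoSidedSumLtimes_monoAnalyticizationHomotopies p 𝔄 V₁ V₂) :=
  sumMonoTelecoreCoherence (monoTelecoreCoherence_openLtimes p V₁) (archGenuinePlus_monoTelecoreCoherence 𝔄 V₂ (fun _ => true) c hc hcob)

/-- ★★ **PINNED Cor 5.10 (iv)(b)(c) AT THE TWO-SIDED `⋉`-CARRIER** (`V₁ ⊕ V₂ ≠ ∅`), under the orientation cochain: abc-iut-f-101's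
sufficiency theorem (relay slice T7b) fed BY NAME with the summand-wise coherence add-on.
[cite: MochizukiAbsTopIII2015, Cor 5.10 (iv)(b)(c) pp. 147–148] -/
theorem genuineTwoSidedSumLtimes_cor510MonoTelecorePinned [Nonempty (V₁ ⊕ V₂)] (c : 𝔄.EA → ℝ)
    (hc : ∀ X : 𝔄.EA, c X = 1 ∨ c X = -1)
    (hcob : ∀ {X Y : 𝔄.EA} (f : X ⟶ Y), AutHolFieldFunctor.transitionSign f = c X * c Y) :
    (genuineTwoSidedSumLtimes p 𝔄 V₁ V₂).Cor510MonoTelecorePinned :=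
  (genuineTwoSidedSumLtimes_monoTelecoreCoherence p 𝔄 V₁ V₂ c hc hcob).cor510MonoTelecorePinned

/-- ★ the `ι^{An⊢⊞}`-data of the two-sided `⋉`-carrier, summand-wise: the restricted genuine `ι^{An⊢⊞}` at `p` (`ι × 𝟙`) and
abc-iut-L4-t3's `archGenuinePlus_iotaAnMono` (`𝟙 × ιArcTS`) — no cochain needed. [cite: MochizukiAbsTopIII2015, Prop 5.8 (vii) p. 142] -/
def genuineTwoSidedSumLtimes_iotaAnMono :
    (genuineTwoSidedSumLtimes p 𝔄 V₁ V₂).IotaAnMono (genuineTwoSidedSumLtimes_ψOverIso p 𝔄 V₁ V₂) :=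
  sumIotaAnMono (IotaAnMono.toLtimes (genuineOpen p V₁) (nonarchGenuineMonoAnPfOpen_iotaAnMono p V₁ (fun _ => false)))
    (archGenuinePlus_iotaAnMono 𝔄 V₂ (fun _ => true))

/-- … as the `ι`-datum of the summand-wise coherence add-on. [cite: MochizukiAbsTopIII2015, Prop 5.8 (vii) p. 142] -/
def genuineTwoSidedSumLtimes_iotaData (c : 𝔄.EA → ℝ) (hc : ∀ X : 𝔄.EA, c X = 1 ∨ c X = -1)
    (hcob : ∀ {X Y : 𝔄.EA} (f : X ⟶ Y), AutHolFieldFunctor.transitionSign f = c X * c Y) :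
    (genuineTwoSidedSumLtimes_monoTelecoreCoherence p 𝔄 V₁ V₂ c hc hcob).IotaData :=
  sumIotaData (iotaData_openLtimes p V₁) (archGenuinePlus_iotaData 𝔄 V₂ (fun _ => true) c hc hcob)

/-- ★ **the `ι^{An⊢⊞}`-square of Def 5.4 (iii) HOLDS at the two-sided `⋉`-carrier** (`squaresCommute_genuineOpen` restricted ⊕
`archGenuinePlus_squaresCommute`, via `squaresCommute_sum`). [cite: MochizukiAbsTopIII2015, Def 5.4 (iii) p. 126] -/
theorem genuineTwoSidedSumLtimes_squaresCommute : (genuineTwoSidedSumLtimes_iotaAnMono p 𝔄 V₁ V₂).SquaresCommute :=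
  squaresCommute_sum (squaresCommute_openLtimes p V₁) (archGenuinePlus_squaresCommute 𝔄 V₂ (fun _ => true))

/-- ★★ **the `η⊢`-naturality square of Cor 5.10 (iv)(c) HOLDS at the two-sided `⋉`-carrier**, summand-wise
(`etaNatural_genuineOpen` restricted ⊕ abc-iut-L4-t3's `archGenuinePlus_etaNatural`, glued by abc-iut-w6-d025's `etaNatural_sum`),
under the orientation cochain. [cite: MochizukiAbsTopIII2015, Cor 5.10 (iv)(c) p. 148] -/
theorem genuineTwoSidedSumLtimes_etaNatural (c : 𝔄.EA → ℝ) (hc : ∀ X : 𝔄.EA, c X = 1 ∨ c X = -1)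
    (hcob : ∀ {X Y : 𝔄.EA} (f : X ⟶ Y), AutHolFieldFunctor.transitionSign f = c X * c Y) :
    (genuineTwoSidedSumLtimes_monoTelecoreCoherence p 𝔄 V₁ V₂ c hc hcob).EtaNatural
      (genuineTwoSidedSumLtimes_iotaData p 𝔄 V₁ V₂ c hc hcob) :=
  etaNatural_sum _ _ (etaNatural_openLtimes p V₁) (archGenuinePlus_etaNatural 𝔄 c hc hcob V₂)

/-- ★★★ **`F-0139″` — the PINNED-WITH-`ι` Cor 5.10 (iv)(b)(c) — HOLDS AT THE TWO-SIDED `⋉`-CARRIER** (`V₁ ⊕ V₂ ≠ ∅`), under the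
orientation cochain: abc-iut-L4-t3's sufficiency theorem over `⋉` (T8-6) fed BY NAME with the summand-wise coherence add-on, its
`ι`-datum, the `ι^{An⊢⊞}`-square and the `η⊢`-square. [cite: MochizukiAbsTopIII2015, Cor 5.10 (iv)(b)(c) pp. 147–148] -/
theorem genuineTwoSidedSumLtimes_cor510MonoTelecorePinnedIota [Nonempty (V₁ ⊕ V₂)] (c : 𝔄.EA → ℝ)
    (hc : ∀ X : 𝔄.EA, c X = 1 ∨ c X = -1)
    (hcob : ∀ {X Y : 𝔄.EA} (f : X ⟶ Y), AutHolFieldFunctor.transitionSign f = c X * c Y) :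
    (genuineTwoSidedSumLtimes p 𝔄 V₁ V₂).Cor510MonoTelecorePinnedIota :=
  (genuineTwoSidedSumLtimes_monoTelecoreCoherence p 𝔄 V₁ V₂ c hc hcob).cor510MonoTelecorePinnedIota_of
    (genuineTwoSidedSumLtimes_iotaData p 𝔄 V₁ V₂ c hc hcob) (genuineTwoSidedSumLtimes_squaresCommute p 𝔄 V₁ V₂)
    (genuineTwoSidedSumLtimes_etaNatural p 𝔄 V₁ V₂ c hc hcob)

/-- Existence form: an orientation cochain for `𝔄` yields the coherence add-on and the PINNED (iv)(b)(c) row at the two-sided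
`⋉`-carrier. [cite: MochizukiAbsTopIII2015, Cor 5.10 (iv)(c) p. 148] -/
theorem genuineTwoSidedSumLtimes_coherent_of_cochain [Nonempty (V₁ ⊕ V₂)]
    (h : ∃ c : 𝔄.EA → ℝ, (∀ X, c X = 1 ∨ c X = -1) ∧
      ∀ {X Y : 𝔄.EA} (f : X ⟶ Y), AutHolFieldFunctor.transitionSign f = c X * c Y) :
    Nonempty ((genuineTwoSidedSumLtimes p 𝔄 V₁ V₂).MonoTelecoreCoherence
        (genuineTwoSidedSumLtimes_monoAnalyticizationHomotopies p 𝔄 V₁ V₂)) ∧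
      (genuineTwoSidedSumLtimes p 𝔄 V₁ V₂).Cor510MonoTelecorePinned := by
  obtain ⟨c, hc, hcob⟩ := h
  exact ⟨⟨genuineTwoSidedSumLtimes_monoTelecoreCoherence p 𝔄 V₁ V₂ c hc hcob⟩,
    genuineTwoSidedSumLtimes_cor510MonoTelecorePinned p 𝔄 V₁ V₂ c hc hcob⟩

/-- Existence form with the `ι`-legs: an orientation cochain yields `(K, I)` with the `ι^{An⊢⊞}`-square, the `η⊢`-square and
the pinned-with-`ι` row at the two-sided `⋉`-carrier. [cite: MochizukiAbsTopIII2015, Cor 5.10 (iv)(c) p. 148] -/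
theorem genuineTwoSidedSumLtimes_etaNatural_of_cochain [Nonempty (V₁ ⊕ V₂)]
    (h : ∃ c : 𝔄.EA → ℝ, (∀ X, c X = 1 ∨ c X = -1) ∧
      ∀ {X Y : 𝔄.EA} (f : X ⟶ Y), AutHolFieldFunctor.transitionSign f = c X * c Y) :
    (∃ (K : (genuineTwoSidedSumLtimes p 𝔄 V₁ V₂).MonoTelecoreCoherence
        (genuineTwoSidedSumLtimes_monoAnalyticizationHomotopies p 𝔄 V₁ V₂)) (I : K.IotaData),
        I.SquaresCommute ∧ K.EtaNatural I) ∧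
      (genuineTwoSidedSumLtimes p 𝔄 V₁ V₂).Cor510MonoTelecorePinnedIota := by
  obtain ⟨c, hc, hcob⟩ := h
  exact ⟨⟨genuineTwoSidedSumLtimes_monoTelecoreCoherence p 𝔄 V₁ V₂ c hc hcob,
      genuineTwoSidedSumLtimes_iotaData p 𝔄 V₁ V₂ c hc hcob, genuineTwoSidedSumLtimes_squaresCommute p 𝔄 V₁ V₂,
      genuineTwoSidedSumLtimes_etaNatural p 𝔄 V₁ V₂ c hc hcob⟩,
    genuineTwoSidedSumLtimes_cor510MonoTelecorePinnedIota p 𝔄 V₁ V₂ c hc hcob⟩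

/-- **Summary at the two-sided `⋉`-carrier**: genuine rows at BOTH place types in one term, its `hψ`, the mono-analyticization
homotopies and Cor 5.10 (iv)(a) — zero hypotheses beyond `V₁ ⊕ V₂ ≠ ∅`. [cite: MochizukiAbsTopIII2015, Prop 5.8 (vii) p. 141] -/
theorem exists_genuineTwoSidedSumLtimes [Nonempty (V₁ ⊕ V₂)] :
    ∃ (Lt : LogFrobeniusSettingLtimes (V₁ ⊕ V₂) (Sum.elim (fun _ => false) (fun _ => true)))
      (hψt : ∀ (w : V₁ ⊕ V₂) (j : {ν : LogVertex (Sum.elim (fun _ => false) (fun _ => true) w) // ν.IsCross}),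
        Lt.ψAnMono w j ⋙ Lt.forgetMono w ⋙ Lt.toEmono w ≅ Lt.κAnMono.inverse),
      Lt.X = ((genuineOpen p V₁).X × (archGenuinePlus 𝔄 V₂ (fun _ => true)).X) ∧
        Nonempty Lt.MonoAnalyticizationHomotopies ∧ Lt.Cor510MonoCores ∧ Nonempty (PLift (hψt = hψt)) :=
  ⟨genuineTwoSidedSumLtimes p 𝔄 V₁ V₂, genuineTwoSidedSumLtimes_ψOverIso p 𝔄 V₁ V₂, rfl,
    ⟨genuineTwoSidedSumLtimes_monoAnalyticizationHomotopies p 𝔄 V₁ V₂⟩, genuineTwoSidedSumLtimes_cor510MonoCores p 𝔄 V₁ V₂, ⟨⟨rfl⟩⟩⟩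

end TwoSided

end LogFrobeniusSettingLtimes

/-! ## §3. The geometric case: zero hypotheses -/

namespace HolRS

open LogFrobeniusSetting LogFrobeniusSettingLtimes

/-- ★★★ **At the geometric Aut-holomorphic field functor of any class `Q` of hyperbolic Riemann surfaces, the coherence add-on AND
the PINNED Cor 5.10 (iv)(b)(c) row HOLD at the two-sided `⋉`-carrier with ZERO hypotheses** beyond `V₁ ⊕ V₂ ≠ ∅` (every transition sign is
`+1` there: `exists_orientationCochain_geometric`). [cite: MochizukiAbsTopIII2015, Cor 5.10 (iv)(b)(c) pp. 147–148] -/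
theorem cor510MonoTelecorePinned_genuineTwoSidedSumLtimes_geometric (p : ℕ) [Fact p.Prime] (Q : ObjectProperty HolRS)
    (V₁ V₂ : Type 1) [Nonempty (V₁ ⊕ V₂)] :
    Nonempty ((genuineTwoSidedSumLtimes p (geometricAutHolFieldFunctor Q) V₁ V₂).MonoTelecoreCoherence
        (genuineTwoSidedSumLtimes_monoAnalyticizationHomotopies p (geometricAutHolFieldFunctor Q) V₁ V₂)) ∧
      (genuineTwoSidedSumLtimes p (geometricAutHolFieldFunctor Q) V₁ V₂).Cor510MonoTelecorePinned :=
  genuineTwoSidedSumLtimes_coherent_of_cochain p _ V₁ V₂ (exists_orientationCochain_geometric Q)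

/-- ★★★ **… and so does the PINNED-WITH-`ι` row `F-0139″`, with its `ι^{An⊢⊞}`-square and `η⊢`-square — ZERO hypotheses** beyond
`V₁ ⊕ V₂ ≠ ∅`, at the geometric Aut-holomorphic field functor. [cite: MochizukiAbsTopIII2015, Cor 5.10 (iv)(c) p. 148] -/
theorem cor510MonoTelecorePinnedIota_genuineTwoSidedSumLtimes_geometric (p : ℕ) [Fact p.Prime] (Q : ObjectProperty HolRS)
    (V₁ V₂ : Type 1) [Nonempty (V₁ ⊕ V₂)] :
    (∃ (K : (genuineTwoSidedSumLtimes p (geometricAutHolFieldFunctor Q) V₁ V₂).MonoTelecoreCoherence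
        (genuineTwoSidedSumLtimes_monoAnalyticizationHomotopies p (geometricAutHolFieldFunctor Q) V₁ V₂)) (I : K.IotaData),
        I.SquaresCommute ∧ K.EtaNatural I) ∧
      (genuineTwoSidedSumLtimes p (geometricAutHolFieldFunctor Q) V₁ V₂).Cor510MonoTelecorePinnedIota :=
  genuineTwoSidedSumLtimes_etaNatural_of_cochain p _ V₁ V₂ (exists_orientationCochain_geometric Q)

/-- … hence a `⋉`-setting over `V₁ ⊕ V₂` carrying genuine nonarchimedean rows at the places of `V₁` and genuine archimedean rows at
the places of `V₂`, with Cor 5.10 (iv)(a), the PINNED (iv)(b)(c) AND the pinned-with-`ι` row, EXISTS with no hypothesis beyond `V₁ ⊕ V₂ ≠ ∅`.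
[cite: MochizukiAbsTopIII2015, Cor 5.10 (iv) pp. 147–148] -/
theorem exists_twoSided_ltimes_cor510 (p : ℕ) [Fact p.Prime] (Q : ObjectProperty HolRS) (V₁ V₂ : Type 1)
    [Nonempty (V₁ ⊕ V₂)] :
    ∃ Lt : LogFrobeniusSettingLtimes (V₁ ⊕ V₂) (Sum.elim (fun _ => false) (fun _ => true)),
      Lt.Cor510MonoCores ∧ Lt.Cor510MonoTelecorePinned ∧ Lt.Cor510MonoTelecorePinnedIota :=
  ⟨genuineTwoSidedSumLtimes p (geometricAutHolFieldFunctor Q) V₁ V₂,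
    genuineTwoSidedSumLtimes_cor510MonoCores p _ V₁ V₂,
    (cor510MonoTelecorePinned_genuineTwoSidedSumLtimes_geometric p Q V₁ V₂).2,
    (cor510MonoTelecorePinnedIota_genuineTwoSidedSumLtimes_geometric p Q V₁ V₂).2⟩

end HolRS

end Literature.AnabelianGeometry.AbsoluteAnabelian

end
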